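import Literature.Computability.AlgebraicComplexity.LandsbergRessayreNormalForm
import HarnessLib

/-!
# Regular determinantal representations are single-matrix homogeneous ABPs
# (Chatterjee–Kumar–Volk 2024, Thm. 13 and the remark following its proof)

Topic `Literature/Computability/AlgebraicComplexity` (vocabulary: `IsAffineDetRepr`,
`IsRegularDetRepr`, `constPart` of `DeterminantalComplexity.lean` / `LandsbergRessayreNormalForm.lean`).
Cite item `wi-29877` (crux stmt-ValiantsHypothesis-0318, line linear-homogenisation-transfer: stubs
S1a `stub_vertexGauge` + S1b `stub_krylovIdentities`, parts (A1)–(A3)).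

* NAMED FACT `ChatterjeeKumarVolk2024_thm13` — over any field, a homogeneous `f` of degree
  `d ≥ 2` with a REGULAR affine determinantal representation of size `s` is `f = −bᵀ D^{d−2} c`
  for vectors `b, c` and an `(s−1) × (s−1)` matrix `D` of homogeneous LINEAR forms, with
  `bᵀ Dⁱ c = 0` for `0 ≤ i ≤ d − 3` (a homogeneous ABP of width `s − 1` all of whose middle layers
  are the same matrix `D`). Not proved here (SIZE M: LR normal form `IsRegularDetRepr.exists_normalForm`
  + Schur complement over `F[[x]]` + comparison of homogeneous components — the printed half page).

## What is printed (arXiv:2308.04599 §3, read; comput. complexity 33 (2024))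

**Theorem 13.** *Let `f ∈ 𝔽[x₁, …, xₙ]` be a homogeneous polynomial of degree `d ≥ 2`. Suppose
`rdc(f) = s`. Then `habpw(f) ≤ s − 1` (and in particular, `abp(f) ≤ habp(f) = O(ds)`).* Here
(Def. 7) a determinantal representation of size `s` is an `s × s` matrix of linear functions with
`Det(M) = f`; it is *regular* if its constant part `M₀ = M(0)` has rank `s − 1`; `rdc(f)` is the
least size of a regular one. **Proof** (ibid.): "by applying elementary row and column operations
we may assume that `M₀ = diag(0,1,…,1)`. Thus, we can write `M` in blocks as `M = [[a, bᵀ],[c, I − D]]`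
where `a(x)` is a homogeneous linear polynomial, `b, c ∈ 𝔽^{s−1}` are vectors of homogeneous linear
polynomials, and `D ∈ 𝔽^{(s−1)×(s−1)}` is a matrix of homogeneous linear polynomials. We now claim
that `f = −bᵀ (D^{d−2}) c` …" (Schur complement: `f = Det(I−D)·(a − bᵀ(I−D)⁻¹c)`,
`(I−D)⁻¹ = Σ Dⁱ` in `𝔽[[x]]`, `Det(I−D) = 1 + R`, and the lowest non-zero homogeneous component of
the right-hand side is `f`, of degree `d ≥ 2`). **Remark after the proof**: "Apart from the first
and last layers, all the middle layers are identical and have the same transition matrix `D`.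
Further, `b, c` and `D` satisfy the equations `bᵀ Dⁱ c = 0` for all `0 ≤ i ≤ d − 3`."
**Corollary 14**: the same for every homogeneous `f` of degree `d ≥ 2` with `dim Sing(f) < n − 4`
(all its representations are regular, von zur Gathen 1987 — in the tree for the permanent:
`vonzurGathen1987_perm_detRepr_rank`, `isRegularDetRepr_perPoly`).

## Vended form

For a field `F`, a FINITE variable type `σ`, `f : MvPolynomial σ F` homogeneous of degree `d`
(`IsHomogeneous f d`), `2 ≤ d`, and `A : Matrix (Fin s) (Fin s) (MvPolynomial σ F)` with
`IsRegularDetRepr f A` (affine entries, `det A = f`, `rank A(0) = s − 1`): there are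
`b c : Fin (s−1) → MvPolynomial σ F` and `D : Matrix (Fin (s−1)) (Fin (s−1)) (MvPolynomial σ F)`
with all entries homogeneous of degree `1`, `f = −(b ⬝ᵥ D^{d−2} *ᵥ c)` and
`b ⬝ᵥ Dⁱ *ᵥ c = 0` whenever `i + 3 ≤ d`. This is the content of the proof + remark for the given
representation (the theorem's `habpw(f) ≤ s − 1` is its corollary); the conjugating constant
matrices and the vanishing of `a` are not exported. Degenerate sizes are excluded by the
hypotheses (`s = 0` forces `f = 1`, not homogeneous of degree `≥ 2`).
-/

noncomputable section

open Matrix MvPolynomial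

namespace Literature.Computability.AlgebraicComplexity

universe u v

variable {F : Type u} [Field F]

/-- **Chatterjee–Kumar–Volk 2024, Thm. 13 with the remark following its proof** (named fact, not
proved here): over a field `F`, if `f ∈ F[x_σ]` (`σ` finite) is homogeneous of degree `d ≥ 2` and
`A` is a REGULAR affine determinantal representation of `f` of size `s` (`IsRegularDetRepr f A`:
entries of total degree `≤ 1`, `det A = f`, `rank A(0) = s − 1`), then there are vectors `b, c`
and an `(s−1) × (s−1)` matrix `D` of homogeneous LINEAR forms with `f = −bᵀ D^{d−2} c` and
`bᵀ Dⁱ c = 0` for all `0 ≤ i ≤ d − 3` — "`−bᵀ D^{d−2} c` is a homogeneous ABP that computes `f`",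
all middle layers equal to `D`, so `habpw(f) ≤ s − 1`. Users take
`(h : ChatterjeeKumarVolk2024_thm13)`.
[cite: ChatterjeeKumarVolk2024, Thm. 13 + remark after its proof (arXiv:2308.04599 §3); Cor. 14] -/
def ChatterjeeKumarVolk2024_thm13 : Prop :=
  ∀ (σ : Type v) [Fintype σ] (f : MvPolynomial σ F) (d s : ℕ), f.IsHomogeneous d → 2 ≤ d →
    ∀ A : Matrix (Fin s) (Fin s) (MvPolynomial σ F), IsRegularDetRepr f A →
      ∃ (b c : Fin (s - 1) → MvPolynomial σ F)
        (D : Matrix (Fin (s - 1)) (Fin (s - 1)) (MvPolynomial σ F)),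
        (∀ i, (b i).IsHomogeneous 1) ∧ (∀ i, (c i).IsHomogeneous 1) ∧
        (∀ i j, (D i j).IsHomogeneous 1) ∧
        f = -(b ⬝ᵥ (D ^ (d - 2)) *ᵥ c) ∧
        ∀ i : ℕ, i + 3 ≤ d → b ⬝ᵥ (D ^ i) *ᵥ c = 0

/-- Corollary (the theorem's displayed conclusion, one representation at a time): under the
hypotheses of `ChatterjeeKumarVolk2024_thm13`, `f` is computed by a homogeneous ABP of width
`s − 1` whose `d − 2` middle layers are one and the same matrix — `f = −bᵀ D^{d−2} c` with
homogeneous linear `b, c, D` (forgetting the vanishing identities).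
[cite: ChatterjeeKumarVolk2024, Thm. 13] -/
theorem ChatterjeeKumarVolk2024_thm13.exists_eq_neg_dotProduct_pow
    (h : ChatterjeeKumarVolk2024_thm13.{u, v} (F := F)) {σ : Type v} [Fintype σ] {f : MvPolynomial σ F}
    {d s : ℕ} (hf : f.IsHomogeneous d) (hd : 2 ≤ d)
    {A : Matrix (Fin s) (Fin s) (MvPolynomial σ F)} (hA : IsRegularDetRepr f A) :
    ∃ (b c : Fin (s - 1) → MvPolynomial σ F)
      (D : Matrix (Fin (s - 1)) (Fin (s - 1)) (MvPolynomial σ F)),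
      (∀ i, (b i).IsHomogeneous 1) ∧ (∀ i, (c i).IsHomogeneous 1) ∧
      (∀ i j, (D i j).IsHomogeneous 1) ∧ f = -(b ⬝ᵥ (D ^ (d - 2)) *ᵥ c) := by
  obtain ⟨b, c, D, hb, hc, hD, hf', -⟩ := h σ f d s hf hd A hA
  exact ⟨b, c, D, hb, hc, hD, hf'⟩

end Literature.Computability.AlgebraicComplexity
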